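import Summits.MatrixMultiplication.OmegaCensus.STPP222IcosetWSearchPrims
import Mathlib.Data.Fin.Tuple.Sort
import Mathlib.Data.List.Sort
import Mathlib.Data.ZMod.Basic

/-!
# ω-census, icoset class at 2-rank four: the H-stage of the kernel engine, I — `lexLt`, argmin, codes, `rebased` as insertion sort

HONEST FRAMING (pub-omega census; verbatim): lottery ticket; floor = certified bounds/negative ranges.
Census STRUCTURE bookkeeping (Q7, the involution-coset class), nothing about `ω`.

Semantics of the H-stage of `STPP222IcosetWSearch.lean` for `H = ZMod n`, part I: the engine's lexicographic test `lexLt` is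
transitive and irreflexive, so a list `argmin2` over candidates has nothing strictly below it; the `H`-data `(β_t, γ_t)_{t<K}` is
coded `n·β + γ` (`code`), re-based at `b` and scaled by `u` it is `cfunN β γ b u`, the engine's one-code transform is exactly this
re-basing (`transform_eq`, `transform_cfun`: re-basing a re-based code function is a re-basing of the original), and the engine's
`rebased n K C b u` is the INSERTION SORT `insList` of the transformed codes over `t ≠ b` (`rebased_eq_rebRec`, `rebRec_eq_insList`,
`insList_perm`, `insList_sorted`, `insList_congr`).  Part II (sorting relabelling, canonical representative): `STPP222IcosetRankFourCanon.lean`.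
Seat pub-omega-kernel-l4 (gen 20), 2026-08-27.
-/

namespace Summit.MatrixMultiplication.OmegaCensus

namespace IcosetW

open IcosetH (getI allN allN_true getI_eq_getD)

/-! ## `lexLt` -/

/-- `lexLt` on conses. -/
theorem lexLt_cons (x y : ℕ) (xs ys : List ℕ) : lexLt (x :: xs) (y :: ys) = (Nat.blt x y || (Nat.beq x y && lexLt xs ys)) := rfl
/-- Nothing is below `[]`. -/
theorem lexLt_nil_right (l : List ℕ) : lexLt l [] = false := by cases l <;> rfl

/-- `lexLt` is transitive. -/
theorem lexLt_trans : ∀ (a b c : List ℕ), lexLt a b = true → lexLt b c = true → lexLt a c = true := by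
  intro a
  induction a with
  | nil =>
    intro b c _ hbc
    cases c with
    | nil => rw [lexLt_nil_right] at hbc; exact absurd hbc (by decide)
    | cons z zs => rfl
  | cons x xs ih =>
    intro b c hab hbc
    cases b with
    | nil => rw [lexLt_nil_right] at hab; exact absurd hab (by decide)
    | cons y ys =>
      cases c with
      | nil => rw [lexLt_nil_right] at hbc; exact absurd hbc (by decide)
      | cons z zs =>
        rw [lexLt_cons] at hab hbc ⊢
        simp only [Bool.or_eq_true, Bool.and_eq_true, Nat.blt_eq, Nat.beq_eq] at hab hbc ⊢
        rcases hab with h1 | ⟨rfl, h1⟩ <;> rcases hbc with h2 | ⟨rfl, h2⟩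
        · exact Or.inl (lt_trans h1 h2)
        · exact Or.inl h1
        · exact Or.inl h2
        · exact Or.inr ⟨rfl, ih _ _ h1 h2⟩

/-- `lexLt l l = false`. -/
theorem lexLt_irrefl (l : List ℕ) : lexLt l l = false := by
  induction l with
  | nil => rfl
  | cons x xs ih =>
    rw [lexLt_cons, ih]
    have : Nat.blt x x = false := by
      cases e : Nat.blt x x with
      | false => rfl
      | true => simp [Nat.blt_eq] at e
    rw [this]; simp

/-! ## Argmin over a list of candidates (transitivity and irreflexivity only) -/

/-- The candidate with the least value (first on ties), starting from `p₀`. -/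
noncomputable def argmin2 (val : ℕ × ℕ → List ℕ) (p₀ : ℕ × ℕ) (l : List (ℕ × ℕ)) : ℕ × ℕ :=
  l.foldl (fun m p => if lexLt (val p) (val m) = true then p else m) p₀

/-- One step of `argmin2`. -/
theorem argmin2_cons (val : ℕ × ℕ → List ℕ) (p₀ q : ℕ × ℕ) (l : List (ℕ × ℕ)) :
    argmin2 val p₀ (q :: l) = argmin2 val (if lexLt (val q) (val p₀) = true then q else p₀) l := rfl

/-- Invariant form of the argmin property. -/
theorem argmin2_aux (val : ℕ × ℕ → List ℕ) : ∀ (l P : List (ℕ × ℕ)) (p₀ : ℕ × ℕ), p₀ ∈ P →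
    (∀ p ∈ P, lexLt (val p) (val p₀) = false) →
    (argmin2 val p₀ l ∈ P ∨ argmin2 val p₀ l ∈ l) ∧ ∀ p ∈ P ++ l, lexLt (val p) (val (argmin2 val p₀ l)) = false := by
  intro l
  induction l with
  | nil =>
    intro P p₀ h0 hP
    exact ⟨Or.inl h0, fun p hp => hP p (by simpa using hp)⟩
  | cons q l ih =>
    intro P p₀ h0 hP
    rw [argmin2_cons]
    by_cases hq : lexLt (val q) (val p₀) = true
    · rw [if_pos hq]
      have hP' : ∀ p ∈ q :: P, lexLt (val p) (val q) = false := by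
        intro p hp
        rcases List.mem_cons.1 hp with rfl | hp
        · exact lexLt_irrefl _
        · cases e : lexLt (val p) (val q)
          · rfl
          · have := lexLt_trans _ _ _ e hq; rw [hP p hp] at this; exact absurd this (by decide)
      obtain ⟨h1, h2⟩ := ih (q :: P) q List.mem_cons_self hP'
      refine ⟨?_, fun p hp => h2 p ?_⟩
      · rcases h1 with h | h
        · rcases List.mem_cons.1 h with h | h
          · exact Or.inr (by rw [h]; exact List.mem_cons_self)
          · exact Or.inl h
        · exact Or.inr (List.mem_cons_of_mem _ h)
      · rcases List.mem_append.1 hp with hp | hp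
        · exact List.mem_append.2 (Or.inl (List.mem_cons_of_mem _ hp))
        · rcases List.mem_cons.1 hp with rfl | hp
          · exact List.mem_append.2 (Or.inl List.mem_cons_self)
          · exact List.mem_append.2 (Or.inr hp)
    · rw [if_neg hq]
      have hP' : ∀ p ∈ q :: P, lexLt (val p) (val p₀) = false := by
        intro p hp
        rcases List.mem_cons.1 hp with rfl | hp
        · simpa using hq
        · exact hP p hp
      obtain ⟨h1, h2⟩ := ih (q :: P) p₀ (List.mem_cons_of_mem _ h0) hP'
      refine ⟨?_, fun p hp => h2 p ?_⟩
      · rcases h1 with h | h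
        · rcases List.mem_cons.1 h with h | h
          · exact Or.inr (by rw [h]; exact List.mem_cons_self)
          · exact Or.inl h
        · exact Or.inr (List.mem_cons_of_mem _ h)
      · rcases List.mem_append.1 hp with hp | hp
        · exact List.mem_append.2 (Or.inl (List.mem_cons_of_mem _ hp))
        · rcases List.mem_cons.1 hp with rfl | hp
          · exact List.mem_append.2 (Or.inl List.mem_cons_self)
          · exact List.mem_append.2 (Or.inr hp)

/-- **The argmin**: it is `p₀` or a candidate, and no candidate (nor `p₀`) is strictly below it. -/
theorem argmin2_spec (val : ℕ × ℕ → List ℕ) (l : List (ℕ × ℕ)) (p₀ : ℕ × ℕ) :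
    (argmin2 val p₀ l = p₀ ∨ argmin2 val p₀ l ∈ l) ∧ lexLt (val p₀) (val (argmin2 val p₀ l)) = false ∧
      ∀ p ∈ l, lexLt (val p) (val (argmin2 val p₀ l)) = false := by
  obtain ⟨h1, h2⟩ := argmin2_aux val l [p₀] p₀ List.mem_cons_self (fun p hp => by
    rw [List.mem_singleton.1 hp]; exact lexLt_irrefl _)
  refine ⟨?_, h2 p₀ (List.mem_append.2 (Or.inl List.mem_cons_self)), fun p hp => h2 p (List.mem_append.2 (Or.inr hp))⟩
  rcases h1 with h | h
  · exact Or.inl (List.mem_singleton.1 h)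
  · exact Or.inr h

/-! ## Codes of `H`-data and the engine's transform -/

section Codes
variable {n : ℕ} [NeZero n]

/-- The code of a pair of residues. -/
def code (x y : ZMod n) : ℕ := n * x.val + y.val

/-- Codes are below `n²`. -/
theorem code_lt (x y : ZMod n) : code x y < n * n := by
  unfold code
  have hx := ZMod.val_lt x; have hy := ZMod.val_lt y
  calc n * x.val + y.val < n * x.val + n := by omega
    _ = n * (x.val + 1) := by ring
    _ ≤ n * n := Nat.mul_le_mul_left _ hx

/-- Decoding a code. -/
theorem code_div_mod (x y : ZMod n) : code x y / n = x.val ∧ code x y % n = y.val := by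
  have hn : 0 < n := Nat.pos_of_ne_zero (NeZero.ne n)
  have hy := ZMod.val_lt y
  unfold code
  constructor
  · rw [Nat.mul_add_div hn, Nat.div_eq_of_lt hy, Nat.add_zero]
  · rw [Nat.mul_add_mod]; exact Nat.mod_eq_of_lt hy

/-- The engine's re-basing transform of one decoded pair is the code of the re-based scaled pair. -/
theorem transform_eq (u : ℕ) (x y x₀ y₀ : ZMod n) :
    n * (u * (x.val + (n - x₀.val)) % n) + u * (y.val + (n - y₀.val)) % n =
      code ((u : ZMod n) * (x - x₀)) ((u : ZMod n) * (y - y₀)) := by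
  have key : ∀ a a₀ : ZMod n, u * (a.val + (n - a₀.val)) % n = ((u : ZMod n) * (a - a₀)).val := by
    intro a a₀
    rw [← ZMod.val_natCast]
    congr 1
    push_cast
    rw [Nat.cast_sub (le_of_lt (ZMod.val_lt a₀))]
    simp [ZMod.natCast_val]
    ring
  unfold code; rw [key, key]

/-- `H`-data as functions on `ℕ` (junk `0` beyond `K`) and the re-based, scaled code function. -/
def cfunN {K : ℕ} (β γ : Fin K → ZMod n) (b : ℕ) (u : ZMod n) (s : ℕ) : ℕ :=
  if hs : s < K then
    if hb : b < K then code (u * (β ⟨s, hs⟩ - β ⟨b, hb⟩)) (u * (γ ⟨s, hs⟩ - γ ⟨b, hb⟩)) else 0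
  else 0

omit [NeZero n] in
/-- `cfunN` at indices in range. -/
theorem cfunN_eq {K : ℕ} (β γ : Fin K → ZMod n) {b s : ℕ} (hb : b < K) (hs : s < K) (u : ZMod n) :
    cfunN β γ b u s = code (u * (β ⟨s, hs⟩ - β ⟨b, hb⟩)) (u * (γ ⟨s, hs⟩ - γ ⟨b, hb⟩)) := by
  unfold cfunN; rw [dif_pos hs, dif_pos hb]

/-- **Transform of a transform.**  Re-basing the code function `cfunN β γ b₀ u₀ ∘ σ` at `b` with unit `u` gives
`cfunN β γ (σ b) (u·u₀) ∘ σ`. -/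
theorem transform_cfun {K : ℕ} (β γ : Fin K → ZMod n) {b₀ : ℕ} (hb₀ : b₀ < K) (u₀ : ZMod n) (σ : ℕ → ℕ)
    (hσ : ∀ t, t < K → σ t < K) (u : ℕ) {b s : ℕ} (hb : b < K) (hs : s < K) :
    n * (u * (cfunN β γ b₀ u₀ (σ s) / n + (n - cfunN β γ b₀ u₀ (σ b) / n)) % n) +
      u * (cfunN β γ b₀ u₀ (σ s) % n + (n - cfunN β γ b₀ u₀ (σ b) % n)) % n = cfunN β γ (σ b) ((u : ZMod n) * u₀) (σ s) := by
  rw [cfunN_eq β γ hb₀ (hσ s hs), cfunN_eq β γ hb₀ (hσ b hb), cfunN_eq β γ (hσ b hb) (hσ s hs)]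
  obtain ⟨d1, m1⟩ := code_div_mod (u₀ * (β ⟨σ s, hσ s hs⟩ - β ⟨b₀, hb₀⟩)) (u₀ * (γ ⟨σ s, hσ s hs⟩ - γ ⟨b₀, hb₀⟩))
  obtain ⟨d2, m2⟩ := code_div_mod (u₀ * (β ⟨σ b, hσ b hb⟩ - β ⟨b₀, hb₀⟩)) (u₀ * (γ ⟨σ b, hσ b hb⟩ - γ ⟨b₀, hb₀⟩))
  rw [d1, m1, d2, m2, transform_eq]
  congr 1 <;> ring

end Codes

/-! ## `rebased` is an insertion sort -/

/-- Insertion-sort fold of `f` over `t < m`, `t ≠ b`. -/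
def insList (f : ℕ → ℕ) (b : ℕ) : ℕ → List ℕ
  | 0 => []
  | m + 1 => if m = b then insList f b m else (insList f b m).orderedInsert (· ≤ ·) (f m)

/-- The engine's `insSorted` is `orderedInsert (· ≤ ·)`. -/
theorem insSorted_eq (x : ℕ) (l : List ℕ) : insSorted x l = l.orderedInsert (· ≤ ·) x := by
  induction l with
  | nil => rfl
  | cons y ys ih =>
    show cnd (Nat.ble x y) (x :: y :: ys) (y :: insSorted x ys) = _
    rw [List.orderedInsert_cons, cnd_eq_ite, ih]
    by_cases h : x ≤ y
    · rw [if_pos (Nat.ble_eq_true_of_le h), if_pos h]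
    · have : Nat.ble x y = false := by
        cases e : Nat.ble x y with
        | false => rfl
        | true => exact absurd (Nat.le_of_ble_eq_true e) h
      rw [this, if_neg h]; rfl

/-- The recursion inside `rebased`. -/
noncomputable def rebRec (n : ℕ) (C : List ℕ) (b u bb gb : ℕ) (m : ℕ) : List ℕ :=
  @Nat.rec (fun _ => List ℕ) [] (fun t acc => frcL acc fun acc =>
    cnd (Nat.beq t b) acc
      (insSorted (Nat.add (Nat.mul n (Nat.mod (Nat.mul u (Nat.add (Nat.div (getI C t) n) (Nat.sub n bb))) n))
          (Nat.mod (Nat.mul u (Nat.add (Nat.mod (getI C t) n) (Nat.sub n gb))) n)) acc)) m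

/-- `rebased` in terms of `rebRec`. -/
theorem rebased_eq_rebRec (n K : ℕ) (C : List ℕ) (b u : ℕ) :
    rebased n K C b u = rebRec n C b u (Nat.div (getI C b) n) (Nat.mod (getI C b) n) K := by
  unfold rebased; simp only [frc_eq]; rfl

/-- `rebRec` is `insList` of the engine's transform. -/
theorem rebRec_eq_insList (n : ℕ) (C : List ℕ) (b u bb gb : ℕ) : ∀ m, rebRec n C b u bb gb m =
    insList (fun t => n * (u * (getI C t / n + (n - bb)) % n) + u * (getI C t % n + (n - gb)) % n) b m := by
  intro m
  induction m with
  | zero => rfl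
  | succ m ih =>
    show frcL (rebRec n C b u bb gb m) (fun acc => cnd (Nat.beq m b) acc (insSorted _ acc)) = _
    rw [frcL_eq, cnd_eq_ite, ih, insSorted_eq]
    simp only [Nat.beq_eq, insList]
    rfl

/-- `insList` is a permutation of the mapped index list. -/
theorem insList_perm (f : ℕ → ℕ) (b : ℕ) : ∀ m, (insList f b m).Perm (((List.range m).filter (· ≠ b)).map f) := by
  intro m
  induction m with
  | zero => exact List.Perm.refl _
  | succ m ih =>
    rw [List.range_succ, List.filter_append, List.map_append]
    simp only [insList]
    by_cases h : m = b
    · rw [if_pos h]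
      have : List.filter (fun x => decide (x ≠ b)) [m] = [] := by simp [h]
      rw [this, List.map_nil, List.append_nil]; exact ih
    · rw [if_neg h]
      have : List.filter (fun x => decide (x ≠ b)) [m] = [m] := by simp [h]
      rw [this, List.map_cons, List.map_nil]
      exact (List.perm_orderedInsert _ _ _).trans ((List.Perm.cons (f m) ih).trans (List.perm_append_singleton _ _).symm)

/-- `insList` is sorted. -/
theorem insList_sorted (f : ℕ → ℕ) (b : ℕ) : ∀ m, (insList f b m).Pairwise (· ≤ ·) := by
  intro m
  induction m with
  | zero => exact List.Pairwise.nil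
  | succ m ih =>
    simp only [insList]
    split_ifs
    · exact ih
    · exact ih.orderedInsert _ _

/-- `insList` only looks at `f` on `t < m`, `t ≠ b`. -/
theorem insList_congr {f g : ℕ → ℕ} {b : ℕ} : ∀ m, (∀ t, t < m → t ≠ b → f t = g t) → insList f b m = insList g b m := by
  intro m
  induction m with
  | zero => intro _; rfl
  | succ m ih =>
    intro h
    simp only [insList]
    rw [ih fun t ht hb => h t (Nat.lt_succ_of_lt ht) hb]
    split_ifs with hb
    · rfl
    · rw [h m (Nat.lt_succ_self m) hb]

end IcosetW

end Summit.MatrixMultiplication.OmegaCensus
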